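import Literature.Computability.AlgebraicComplexity.SymmetricCircuitGradient
import Mathlib.Algebra.MvPolynomial.PDeriv
import HarnessLib

/-!
# Symmetric circuits: the forward-mode gradient circuit (semantics, symmetry, size)

Topic `Computability/AlgebraicComplexity`, namespace `Literature.Computability.AlgebraicComplexity`.
Continuation of `SymmetricCircuitGradient.lean` (the gadget
`LabelledArithCircuit.Gradient.gradCircuit P y₀` built on a Dawar–Wilsenach labelled circuit `P`
with a designated output index `y₀`; A. Dawar, G. Wilsenach, *Symmetric Arithmetic Circuits*,
Theory of Computing 21 (2025), Defs. 2.2, 3.6, 3.7):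

* SEMANTICS (`eval_gradCircuit_old`, `eval_term`, `eval_der`, `eval_gradCircuit_output`): old
  gates keep their values, and the derivative gate `der g x` computes `∂_x` of the value of `g`
  (`MvPolynomial.pderiv x`) — forward-mode differentiation: `∂_x x = 1`, `∂_x x' = 0`,
  `∂_x c = 0`, additivity over the children of a sum gate, and the Leibniz rule over the
  children of a product gate (a private `pderiv_children_prod` over commutative semirings);
  so the output `x` computes `∂_x` of the polynomial computed by `P` at `y₀`;
* SYMMETRY (`isAutomorphismExtending_gradPerm`, `isSymmetric_gradCircuit`): an automorphism `π`
  of `P` extending `γ` (Def. 3.6) extends by `der g x ↦ der (π g) (γ • x)`,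
  `term g h x ↦ term (π g) (π h) (γ • x)` (constant gates, hence the sources of `0, 1`, are fixed
  by every automorphism, `IsAutomorphismExtending.apply_eq_self_of_label_const`) as soon as `γ`
  fixes `y₀`; the extension moves the output indices `X` as the variables; so a `Γ`-symmetric
  `P` (Def. 3.7) with `Γ`-fixed `y₀` gives a `Γ`-symmetric gradient circuit;
* SIZE (`card_gGate_le`): at most `(|G| + 1)² (|X| + 1) + 2` gates;
* the packaged statement `LabelledArithCircuit.IsSymmetric.exists_gradient` for single-output
  circuits (`Y = Unit`, `y₀ = ()` is fixed by every action).

Everything is folklore and proved; nothing here is a named fact.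
-/

noncomputable section

open scoped Classical

namespace Literature.Computability.AlgebraicComplexity

open MvPolynomial

universe u v w z

namespace LabelledArithCircuit

namespace Gradient

variable {K : Type u} {X : Type v} {Y : Type z} {G : Type w} [CommSemiring K]
  {P : LabelledArithCircuit K X Y G} {y₀ : Y}

/-! ### The Leibniz rule over a finite product -/

/-- Forward-mode product rule: `∂_x ∏_{i ∈ s} f_i = ∑_{i ∈ s} ∂_x f_i · ∏_{j ∈ s ∖ {i}} f_j`
(private twin, over a commutative SEMIring, of `pderiv_finset_prod` of
`MignonRessayreBound.lean`, which is not imported here). [folklore] -/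
private theorem pderiv_children_prod {ι : Type*} [DecidableEq ι] (x : X) (s : Finset ι)
    (f : ι → MvPolynomial X K) :
    pderiv x (∏ i ∈ s, f i) = ∑ i ∈ s, pderiv x (f i) * ∏ j ∈ s.erase i, f j := by
  induction s using Finset.induction_on with
  | empty => simp
  | insert a s ha ih =>
    rw [Finset.prod_insert ha, Derivation.leibniz, ih, Finset.sum_insert ha,
      Finset.erase_insert ha, smul_eq_mul, smul_eq_mul, Finset.mul_sum, add_comm]
    congr 1
    · exact mul_comm _ _
    · refine Finset.sum_congr rfl fun i hi => ?_
      rw [Finset.erase_insert_of_ne (by rintro rfl; exact ha hi),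
        Finset.prod_insert (fun h => ha (Finset.mem_of_mem_erase h))]
      ring

/-! ### Semantics -/

/-- Old gates keep their values. [cite: DawarWilsenach2025, §2 (evaluation)] -/
theorem eval_gradCircuit_old (g : G) : (gradCircuit P y₀).eval (.old g) = P.eval g := by
  induction g using P.wf.induction with
  | h g ih =>
    have hlab : (gradCircuit P y₀).label (.old g) = P.label g := rfl
    have hch : (gradCircuit P y₀).children (.old g) = (P.children g).map GradGate.oldEmb := rfl
    rcases hl : P.label g with x | c | _ | _
    · rw [P.eval_of_label_var hl, (gradCircuit P y₀).eval_of_label_var (hlab.trans hl)]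
    · rw [P.eval_of_label_const hl, (gradCircuit P y₀).eval_of_label_const (hlab.trans hl)]
    · rw [P.eval_of_label_add hl, (gradCircuit P y₀).eval_of_label_add (hlab.trans hl), hch,
        Finset.sum_map]
      exact Finset.sum_congr rfl fun h hh => ih h hh
    · rw [P.eval_of_label_mul hl, (gradCircuit P y₀).eval_of_label_mul (hlab.trans hl), hch,
        Finset.prod_map]
      exact Finset.prod_congr rfl fun h hh => ih h hh

/-- Constant sources compute their constant. [cite: DawarWilsenach2025, §3.3] -/
theorem eval_gradSrc (c : K) (hc : c ∈ gradCset K) :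
    (gradCircuit P y₀).eval (gradSrc c hc) = MvPolynomial.C c :=
  (gradCircuit P y₀).eval_of_label_const (gradLabel_gradSrc c hc)

/-- The source of `0` computes `0`. [cite: DawarWilsenach2025, §3.3] -/
theorem eval_srcZero : (gradCircuit P y₀).eval (srcZero P) = 0 :=
  (eval_gradSrc 0 mem_gradCset.1).trans MvPolynomial.C_0

/-- The source of `1` computes `1`. [cite: DawarWilsenach2025, §3.3] -/
theorem eval_srcOne : (gradCircuit P y₀).eval (srcOne P) = 1 :=
  (eval_gradSrc 1 mem_gradCset.2).trans MvPolynomial.C_1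

/-- Children of a derivative gate, by the label of the differentiated gate.
[cite: DawarWilsenach2025, Def. 2.2] -/
theorem gradCircuit_children_der {g : G} {l : CircuitLabel K X} (hl : P.label g = l) (x : X) :
    (gradCircuit P y₀).children (.der g x) = derWires P x g l := by
  change derWires P x g (P.label g) = _
  rw [hl]

/-- A Leibniz summand computes `∂_x v_h · ∏_{h' ∈ child(g) ∖ {h}} v_h'`.
[cite: DawarWilsenach2025, §2 (evaluation)] -/
theorem eval_term (g h : G) (x : X) :
    (gradCircuit P y₀).eval (.term g h x) =
      (gradCircuit P y₀).eval (.der h x) * ∏ h' ∈ (P.children g).erase h, P.eval h' := by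
  rw [(gradCircuit P y₀).eval_of_label_mul
    (show (gradCircuit P y₀).label (.term g h x) = .mul from rfl)]
  change ∏ s ∈ insert (GradGate.der h x) (((P.children g).erase h).map GradGate.oldEmb), _ = _
  rw [Finset.prod_insert (fun hm => by
      obtain ⟨h', -, hh'⟩ := Finset.mem_map.1 hm
      exact absurd hh' (by simp)), Finset.prod_map]
  exact congrArg _ (Finset.prod_congr rfl fun h' _ => eval_gradCircuit_old h')

/-- **Forward-mode differentiation.** The derivative gate `der g x` computes `∂_x` of the value
of `g`: `∂_x x = 1`, `∂_x x' = 0`, `∂_x c = 0`, additivity, and the Leibniz rule over the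
children of a product gate. [cite: DawarWilsenach2025, §2 (evaluation)] -/
theorem eval_der (g : G) (x : X) : (gradCircuit P y₀).eval (.der g x) = pderiv x (P.eval g) := by
  induction g using P.wf.induction with
  | h g ih =>
    rw [(gradCircuit P y₀).eval_of_label_add
      (show (gradCircuit P y₀).label (.der g x) = .add from rfl)]
    rcases hl : P.label g with x' | c | _ | _
    · rw [P.eval_of_label_var hl, gradCircuit_children_der hl x]
      simp only [derWires, Finset.sum_singleton]
      split_ifs with hx
      · rw [eval_srcOne, hx, pderiv_X_self]
      · rw [eval_srcZero, pderiv_X_of_ne hx]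
    · rw [P.eval_of_label_const hl, gradCircuit_children_der hl x]
      simp only [derWires, Finset.sum_singleton]
      rw [eval_srcZero, pderiv_C]
    · rw [P.eval_of_label_add hl, gradCircuit_children_der hl x]
      simp only [derWires, Finset.sum_map, GradGate.derEmb_apply, map_sum]
      exact Finset.sum_congr rfl fun h hh => ih h hh
    · rw [P.eval_of_label_mul hl, gradCircuit_children_der hl x]
      simp only [derWires, Finset.sum_map, GradGate.termEmb_apply, pderiv_children_prod]
      exact Finset.sum_congr rfl fun h hh => by rw [eval_term, ih h hh]

/-- **Semantics.** The output indexed by `x` computes `∂_x` of the polynomial computed by `P` at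
`y₀`. [cite: DawarWilsenach2025, §2 (evaluation)] -/
theorem eval_gradCircuit_output (x : X) :
    (gradCircuit P y₀).eval ((gradCircuit P y₀).output x) = pderiv x (P.eval (P.output y₀)) :=
  eval_der _ _

/-! ### Symmetry -/

section Symmetry

variable {Γ : Type*} [Group Γ] [MulAction Γ X] [MulAction Γ Y] {γ : Γ} {π : Equiv.Perm G}

/-- Constant sources are fixed by the extension `GradGate.perm π σ` of an automorphism `π` of `P`
(constant gates are fixed by automorphisms, Def. 3.6). [cite: DawarWilsenach2025, Def. 3.6] -/
theorem perm_gradSrc (hπ : P.IsAutomorphismExtending γ π) (σ : Equiv.Perm X) (c : K)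
    (hc : c ∈ gradCset K) : GradGate.perm π σ (gradSrc c hc : GGate P) = gradSrc c hc := by
  unfold gradSrc
  split_ifs with h
  · change GradGate.old (π h.choose) = GradGate.old h.choose
    rw [hπ.apply_eq_self_of_label_const h.choose_spec]
  · rfl

/-- The source of `0` is fixed. [cite: DawarWilsenach2025, Def. 3.6] -/
theorem perm_srcZero (hπ : P.IsAutomorphismExtending γ π) (σ : Equiv.Perm X) :
    GradGate.perm π σ (srcZero P) = srcZero P :=
  perm_gradSrc hπ σ 0 _

/-- The source of `1` is fixed. [cite: DawarWilsenach2025, Def. 3.6] -/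
theorem perm_srcOne (hπ : P.IsAutomorphismExtending γ π) (σ : Equiv.Perm X) :
    GradGate.perm π σ (srcOne P) = srcOne P :=
  perm_gradSrc hπ σ 1 _

/-- Removing a child commutes with relabelling the gates by a permutation. [folklore] -/
theorem erase_map_perm (π : Equiv.Perm G) (s : Finset G) (h : G) :
    (s.map π.toEmbedding).erase (π h) = (s.erase h).map π.toEmbedding :=
  (Finset.map_erase π.toEmbedding s h).symm

/-- **Symmetry.** If `π` is an automorphism of `P` extending `γ` and `γ` fixes the output index
`y₀`, then `old g ↦ old (π g)`, `der g x ↦ der (π g) (γ • x)`,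
`term g h x ↦ term (π g) (π h) (γ • x)` (new constants fixed) is an automorphism of the gradient
circuit extending `γ` — on the variables AND on the output indices.
[cite: DawarWilsenach2025, Def. 3.6] -/
theorem isAutomorphismExtending_gradPerm (hπ : P.IsAutomorphismExtending γ π) (hy₀ : γ • y₀ = y₀) :
    (gradCircuit P y₀).IsAutomorphismExtending γ (GradGate.perm π (MulAction.toPerm γ)) := by
  refine ⟨fun s => ?_, fun s => ?_, fun x => ?_⟩
  · cases s with
    | old g =>
      change (P.children (π g)).map GradGate.oldEmb =
        ((P.children g).map GradGate.oldEmb).map (Equiv.toEmbedding _)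
      rw [hπ.children_apply, Finset.map_map, Finset.map_map]
      rfl
    | ncst c => exact (Finset.map_empty _).symm
    | der g x =>
      change derWires P (γ • x) (π g) (P.label (π g)) =
        (derWires P x g (P.label g)).map (Equiv.toEmbedding _)
      rw [hπ.label_apply]
      rcases P.label g with x' | c | _ | _
      · simp only [CircuitLabel.smul_var, derWires, smul_left_cancel_iff, Finset.map_singleton,
          Equiv.coe_toEmbedding, apply_ite (GradGate.perm π (MulAction.toPerm γ)),
          perm_srcOne hπ, perm_srcZero hπ]
      · simp only [CircuitLabel.smul_const, derWires, Finset.map_singleton,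
          Equiv.coe_toEmbedding, perm_srcZero hπ]
      · simp only [CircuitLabel.smul_add, derWires]
        rw [hπ.children_apply, Finset.map_map, Finset.map_map]
        rfl
      · simp only [CircuitLabel.smul_mul, derWires]
        rw [hπ.children_apply, Finset.map_map, Finset.map_map]
        rfl
    | term g h x =>
      change insert (GradGate.der (π h) (γ • x))
          (((P.children (π g)).erase (π h)).map GradGate.oldEmb) =
        (insert (GradGate.der h x) (((P.children g).erase h).map GradGate.oldEmb)).map
          (Equiv.toEmbedding _)
      rw [Finset.map_insert, Finset.map_map, hπ.children_apply, erase_map_perm, Finset.map_map]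
      rfl
  · cases s with
    | old g => exact hπ.label_apply g
    | _ => rfl
  · change GradGate.der (P.output y₀) (γ • x) = GradGate.der (π (P.output y₀)) (γ • x)
    rw [← hπ.output_smul y₀, hy₀]

/-- A `Γ`-symmetric `P` whose output index `y₀` is `Γ`-fixed gives a `Γ`-symmetric gradient
circuit, `Γ` acting on the output indices as on the variables (Def. 3.7).
[cite: DawarWilsenach2025, Def. 3.7] -/
theorem isSymmetric_gradCircuit (hsym : P.IsSymmetric Γ) (hy₀ : ∀ γ : Γ, γ • y₀ = y₀) :
    (gradCircuit P y₀).IsSymmetric Γ := by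
  intro γ
  obtain ⟨π, hπ⟩ := hsym γ
  exact ⟨_, isAutomorphismExtending_gradPerm hπ (hy₀ γ)⟩

end Symmetry

/-! ### Size -/

/-- `|GradNC| ≤ 2`. [cite: DawarWilsenach2025, Def. 2.2 (size)] -/
theorem card_gradNC_le : Fintype.card (GradNC P) ≤ 2 := by
  calc Fintype.card (GradNC P)
        = ((gradCset K).filter fun c => ∀ g, P.label g ≠ .const c).card :=
        Fintype.subtype_card _ _
    _ ≤ (gradCset K).card := Finset.card_filter_le _ _
    _ ≤ 2 := Finset.card_le_two

/-- **Size.** The gradient circuit has at most `(|G| + 1)² (|X| + 1) + 2` gates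
(`|G| + 2 + |G|·|X| + |G|²·|X|`). [cite: DawarWilsenach2025, Def. 2.2 (size)] -/
theorem card_gGate_le [Fintype G] [Fintype X] :
    Fintype.card (GGate P) ≤ (Fintype.card G + 1) ^ 2 * (Fintype.card X + 1) + 2 := by
  rw [GradGate.card_eq]
  have hc := card_gradNC_le (P := P)
  set n := Fintype.card G
  set m := Fintype.card X
  calc n + Fintype.card (GradNC P) + n * m + n * (n * m)
        ≤ n + 2 + n * m + n * (n * m) := by omega
    _ ≤ n + 2 + n * m + n * (n * m) + (n * n + n * m + n + m + 1) := Nat.le_add_right _ _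
    _ = (n + 1) ^ 2 * (m + 1) + 2 := by ring

end Gradient

/-- **Gradients of symmetric circuits (forward mode).** For any group `Γ` acting on the finite
variable set `X`: a `Γ`-symmetric single-output labelled circuit `C` over `K`, `X` computing `f`
yields a `Γ`-symmetric labelled circuit with outputs indexed by `X` (`Γ` acting on the output
indices as on the variables) whose output `x` computes `∂f/∂x`, on at most
`(|G| + 1)² (|X| + 1) + 2` gates (the construction is `Gradient.gradCircuit`; Dawar–Wilsenach
Defs. 2.2, 3.6, 3.7). [cite: DawarWilsenach2025, Def. 3.7] -/
theorem IsSymmetric.exists_gradient {K : Type u} [CommSemiring K] {X : Type v} [Fintype X]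
    {Γ : Type*} [Group Γ] [MulAction Γ X] [MulAction Γ Unit] {G : Type w} [Fintype G]
    {C : LabelledArithCircuit K X Unit G} (hC : C.IsSymmetric Γ) :
    ∃ (G' : Type (max u v w)) (_ : Fintype G') (C' : LabelledArithCircuit K X X G'),
      C'.IsSymmetric Γ ∧
      (∀ x, C'.eval (C'.output x) = MvPolynomial.pderiv x (C.eval (C.output ()))) ∧
      Fintype.card G' ≤ (Fintype.card G + 1) ^ 2 * (Fintype.card X + 1) + 2 :=
  ⟨Gradient.GGate C, inferInstance, Gradient.gradCircuit C (),
    Gradient.isSymmetric_gradCircuit hC fun _ => rfl, Gradient.eval_gradCircuit_output,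
    Gradient.card_gGate_le⟩

end LabelledArithCircuit

end Literature.Computability.AlgebraicComplexity

end
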